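import Summits.QuantumFields.YangMills.Theorems.UnitScaleTiltSmoothLiftInterpPlaq
import Summits.QuantumFields.YangMills.Theorems.UnitScaleTiltSmoothLiftFibre
import Summits.QuantumFields.YangMills.Theorems.UnitScaleTiltMinimiserStabilityRegPrAvgActionDefect
import Literature.Analysis.Complex.RungeBoxes
import HarnessLib

/-!
# Route `UnitScaleTilt`, crux K1 child «MinimiserStabilityRegPr» (stmt-QuantumFields-19200), stub `stub_smoothLift` (G-K1a-2′) — helper P2c:
# THE SMOOTH INTERPOLATION CARRIES `L^{d−4}` OF THE WILSON ACTION, AND ITS PLAQUETTES ARE `O(a/L² + a² + b′)`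

Fleet seat `ym-ust-19200-p2` (gen 0).  Consequences of the plaquette structure `‖interp V (∂p) − exp(F_{κλ}(y)/L²)‖ ≤ K`,
`K = 2((4d+2)a)² + 3d·b′` (`UnitScaleTiltSmoothLiftInterpPlaq`), for a coarse `SU(2)` field `V` with plaquettes `≤ a` and
covariant-constancy defect `≤ b′`:
* `dist1_plaqHol_interp_le` — every fine plaquette of `interp V` is within `4a/L² + K` of `1` (clause (ii) of `SmoothLiftAt` before
  the exact correction);
* `wilsonAction4_interp_le` — **`L⁴·A(interp V) ≤ L^d·(A(V) + #{coarse plaquettes}·(16a³ + 2aL²K + (4a² + L²K)²))`**: on `SU(2)`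
  `1 − Re tr W = ½|W − 1|²` (`AvgActionDefect.one_sub_reTr_eq_half_dist1_sq_su2`), the `L^d` fine plaquettes over a coarse plaquette
  with curvature `F` contribute `½(|F|/L² + |F|²/L⁴ + K)²` each while the coarse plaquette contributes at least `½(|F| − |F|²)²`
  (`e^F = V(∂p)`), and the blocks partition the fine plaquettes (`AvgActionDefect.sum_coarse_block`).  For `d = 3` this is clause (iv)
  of `SmoothLiftAt` before the exact correction: `L·A(interp V) ≤ A(V) + O(a³ + ab′ + b′² + …)·L^{3(m+K)}`.
[cite: King1986, (A.5) p.676; Balaban1987RG1, (0.2) p.252]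
-/

noncomputable section

open NormedSpace
open scoped Matrix.Norms.L2Operator BigOperators

namespace Summit.QuantumFields.YangMills.Theorems.SmoothLiftInterp

open Literature.MathematicalPhysics.QuantumFieldTheory.Balaban1983to89
open MatrixLog T4Continuum AveragingRT BlockAveraging BlockAveragingSection BlockAveragingSectionPlaq
open Summit.QuantumFields.YangMills.Theorems.SmoothLiftFibre (exp_sub_one_le_two_mul)
open Summit.QuantumFields.YangMills.Theorems.AvgActionDefect (sum_coarse_block one_sub_reTr_eq_half_dist1_sq_su2)

variable {P : Params} {j : ℕ}

/-- `‖e^Y − 1‖ ≤ ‖Y‖ + ‖Y‖²` for `‖Y‖ ≤ 1`. [folklore] -/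
theorem norm_exp_sub_one_le_add_sq {𝔸 : Type*} [NormedRing 𝔸] [NormedAlgebra ℂ 𝔸] [NormOneClass 𝔸] [CompleteSpace 𝔸]
    (Y : 𝔸) (hY : ‖Y‖ ≤ 1) : ‖exp Y - 1‖ ≤ ‖Y‖ + ‖Y‖ ^ 2 := by
  have h1 : exp Y - 1 = (exp Y - 1 - Y) + Y := by abel
  rw [h1]
  refine (norm_add_le _ _).trans ?_
  have h2 := Literature.Analysis.Complex.norm_exp_sub_one_sub_le hY
  linarith

/-- `‖e^Y − 1‖ ≥ ‖Y‖ − ‖Y‖²` for `‖Y‖ ≤ 1`. [folklore] -/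
theorem norm_sub_sq_le_norm_exp_sub_one {𝔸 : Type*} [NormedRing 𝔸] [NormedAlgebra ℂ 𝔸] [NormOneClass 𝔸] [CompleteSpace 𝔸]
    (Y : 𝔸) (hY : ‖Y‖ ≤ 1) : ‖Y‖ - ‖Y‖ ^ 2 ≤ ‖exp Y - 1‖ := by
  have h1 : Y = (exp Y - 1) - (exp Y - 1 - Y) := by abel
  have h2 := Literature.Analysis.Complex.norm_exp_sub_one_sub_le hY
  have h3 : ‖Y‖ ≤ ‖exp Y - 1‖ + ‖exp Y - 1 - Y‖ := by
    calc ‖Y‖ = ‖(exp Y - 1) - (exp Y - 1 - Y)‖ := by rw [← h1]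
      _ ≤ _ := norm_sub_le _ _
  linarith

/-- **THE FINE PLAQUETTES OF THE INTERPOLATION ARE SMALL**: `|interp V (∂p) − 1| ≤ 4a/L² + K`, `K = 2((4d+2)a)² + 3d·b′`.
[cite: King1986, (A.5) p.676] -/
theorem dist1_plaqHol_interp_le (hj : j + 1 ≤ P.m + P.K) (V : GaugeField P (j+1) (Matrix.specialUnitaryGroup (Fin 2) ℂ))
    {a b' : ℝ} (ha : 0 ≤ a) (hb' : 0 ≤ b') (ha1 : (4 * (P.d : ℝ) + 2) * a ≤ 1)
    (hV : ∀ (y : Site P (j+1)) (κ μ : Fin P.d),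
      ‖((plaqElt V y κ μ : Matrix.specialUnitaryGroup (Fin 2) ℂ) : Matrix (Fin 2) (Fin 2) ℂ) - 1‖ ≤ a)
    (hcc : ∀ (y : Site P (j+1)) (κ ρ μ : Fin P.d),
      ‖((V ⟨y, κ⟩ : Matrix.specialUnitaryGroup (Fin 2) ℂ) : Matrix (Fin 2) (Fin 2) ℂ) * curv V (y.shift κ) ρ μ *
          star ((V ⟨y, κ⟩ : Matrix.specialUnitaryGroup (Fin 2) ℂ) : Matrix (Fin 2) (Fin 2) ℂ) - curv V y ρ μ‖ ≤ b')
    (q : Plaq P j) :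
    dist1 (GaugeField.plaqHol (interp V) q) ≤ 4 * a / (P.L : ℝ) ^ 2 + (2 * ((4 * (P.d : ℝ) + 2) * a) ^ 2 + 3 * (P.d : ℝ) * b') := by
  have hL : (0 : ℝ) < P.L := Nat.cast_pos.mpr P.L_pos
  have hL1 : (1 : ℝ) ≤ P.L := by exact_mod_cast P.L_pos
  have hd1 : (1 : ℝ) ≤ P.d := by exact_mod_cast P.hd
  have ha6 : a ≤ 1 / 6 := by nlinarith
  have hstr := norm_plaqHol_interp_sub_exp_le hj V ha hb' ha1 hV hcc q
  set c := curv V (blockOf q.src) q.μ q.ν with hc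
  have hcn : ‖c‖ ≤ 2 * a := (norm_curv_le V _ _ _).trans (by linarith [hV (blockOf q.src) q.μ q.ν])
  have hu : ‖(1 / (P.L : ℝ) ^ 2) • c‖ ≤ 2 * a / (P.L : ℝ) ^ 2 := by
    rw [norm_smul, Real.norm_of_nonneg (by positivity)]
    calc 1 / (P.L : ℝ) ^ 2 * ‖c‖ ≤ 1 / (P.L : ℝ) ^ 2 * (2 * a) := by gcongr
      _ = 2 * a / (P.L : ℝ) ^ 2 := by ring
  have hu1 : 2 * a / (P.L : ℝ) ^ 2 ≤ 1 / 2 := by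
    rw [div_le_iff₀ (by positivity)]; nlinarith
  have hexp : ‖exp ((1 / (P.L : ℝ) ^ 2) • c) - 1‖ ≤ 4 * a / (P.L : ℝ) ^ 2 := by
    refine (Literature.Analysis.Calculus.norm_exp_sub_one_le _).trans ?_
    refine (exp_sub_one_le_two_mul (norm_nonneg _) (hu.trans hu1)).trans ?_
    calc 2 * ‖(1 / (P.L : ℝ) ^ 2) • c‖ ≤ 2 * (2 * a / (P.L : ℝ) ^ 2) := by gcongr
      _ = 4 * a / (P.L : ℝ) ^ 2 := by ring
  have hd : dist1 (GaugeField.plaqHol (interp V) q) =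
      ‖((GaugeField.plaqHol (interp V) q : Matrix.specialUnitaryGroup (Fin 2) ℂ) : Matrix (Fin 2) (Fin 2) ℂ) - 1‖ := rfl
  rw [hd]
  have hsplit : ((GaugeField.plaqHol (interp V) q : Matrix.specialUnitaryGroup (Fin 2) ℂ) : Matrix (Fin 2) (Fin 2) ℂ) - 1 =
      (((GaugeField.plaqHol (interp V) q : Matrix.specialUnitaryGroup (Fin 2) ℂ) : Matrix (Fin 2) (Fin 2) ℂ) -
        exp ((1 / (P.L : ℝ) ^ 2) • c)) + (exp ((1 / (P.L : ℝ) ^ 2) • c) - 1) := by abel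
  rw [hsplit]
  exact (norm_add_le _ _).trans (by linarith)

/-- The scalar bookkeeping of one block: `L⁴·½(n/L² + n²/L⁴ + K)² ≤ ½(n − n²)² + (16a³ + 2aL²K + (4a² + L²K)²)` for
`0 ≤ n ≤ 2a`, `K ≥ 0`, `L ≥ 1`. [folklore] -/
theorem block_arith {L n a K : ℝ} (hL : 1 ≤ L) (hn0 : 0 ≤ n) (hn : n ≤ 2 * a) (hK : 0 ≤ K) :
    L ^ 4 * (1 / 2 * (n / L ^ 2 + (n / L ^ 2) ^ 2 + K) ^ 2) ≤
      1 / 2 * (n - n ^ 2) ^ 2 + (16 * a ^ 3 + 2 * a * L ^ 2 * K + (4 * a ^ 2 + L ^ 2 * K) ^ 2) := by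
  have hL0 : 0 < L := by linarith
  have hL2 : 1 ≤ L ^ 2 := one_le_pow₀ hL
  have hkey : L ^ 4 * (1 / 2 * (n / L ^ 2 + (n / L ^ 2) ^ 2 + K) ^ 2) = 1 / 2 * (n + (n ^ 2 / L ^ 2 + L ^ 2 * K)) ^ 2 := by
    field_simp
    ring
  rw [hkey]
  set α := n ^ 2 / L ^ 2 + L ^ 2 * K with hα
  have h1 : n ^ 2 / L ^ 2 ≤ n ^ 2 := div_le_self (sq_nonneg n) hL2
  have hα0 : 0 ≤ α := by rw [hα]; positivity
  have hn2 : n ^ 2 ≤ 4 * a ^ 2 := by nlinarith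
  have hα1 : α ≤ 4 * a ^ 2 + L ^ 2 * K := by rw [hα]; linarith
  have h3 : n * α ≤ 2 * a * (4 * a ^ 2 + L ^ 2 * K) := mul_le_mul hn hα1 hα0 (by linarith)
  have h4 : α ^ 2 ≤ (4 * a ^ 2 + L ^ 2 * K) ^ 2 := pow_le_pow_left₀ hα0 hα1 2
  have h5 : n ^ 3 ≤ 8 * a ^ 3 := by
    have := pow_le_pow_left₀ hn0 hn 3; nlinarith
  have h6 : 1 / 2 * (n + α) ^ 2 - 1 / 2 * (n - n ^ 2) ^ 2 ≤ n * α + 1 / 2 * α ^ 2 + n ^ 3 := by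
    nlinarith [sq_nonneg n, sq_nonneg (n ^ 2), mul_nonneg hn0 (sq_nonneg n)]
  nlinarith

/-- One fine plaquette with `‖W(∂q) − e^{c/L²}‖ ≤ K`, `‖c‖ = n ≤ 1`: `1 − Re tr W(∂q) ≤ ½(n/L² + (n/L²)² + K)²` on `SU(2)`. [folklore] -/
theorem fine_term_le {W : Matrix.specialUnitaryGroup (Fin 2) ℂ} {c : Matrix (Fin 2) (Fin 2) ℂ} {K : ℝ} (hL : (1 : ℝ) ≤ P.L)
    (hW : ‖(W : Matrix (Fin 2) (Fin 2) ℂ) - exp ((1 / (P.L : ℝ) ^ 2) • c)‖ ≤ K) (hc1 : ‖c‖ ≤ 1) :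
    1 - reTr W ≤ 1 / 2 * (‖c‖ / (P.L : ℝ) ^ 2 + (‖c‖ / (P.L : ℝ) ^ 2) ^ 2 + K) ^ 2 := by
  have hK0 : 0 ≤ K := (norm_nonneg _).trans hW
  rw [one_sub_reTr_eq_half_dist1_sq_su2]
  have hd : dist1 W = ‖(W : Matrix (Fin 2) (Fin 2) ℂ) - 1‖ := rfl
  have hu : ‖(1 / (P.L : ℝ) ^ 2) • c‖ = ‖c‖ / (P.L : ℝ) ^ 2 := by
    rw [norm_smul, Real.norm_of_nonneg (by positivity)]; ring
  have hu1 : ‖(1 / (P.L : ℝ) ^ 2) • c‖ ≤ 1 := by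
    rw [hu]; exact div_le_one_of_le₀ (hc1.trans (one_le_pow₀ hL)) (by positivity)
  have hexp : ‖exp ((1 / (P.L : ℝ) ^ 2) • c) - 1‖ ≤ ‖c‖ / (P.L : ℝ) ^ 2 + (‖c‖ / (P.L : ℝ) ^ 2) ^ 2 := by
    have := norm_exp_sub_one_le_add_sq _ hu1; rwa [hu] at this
  have hdist : dist1 W ≤ ‖c‖ / (P.L : ℝ) ^ 2 + (‖c‖ / (P.L : ℝ) ^ 2) ^ 2 + K := by
    rw [hd]
    have hsplit : (W : Matrix (Fin 2) (Fin 2) ℂ) - 1 =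
        ((W : Matrix (Fin 2) (Fin 2) ℂ) - exp ((1 / (P.L : ℝ) ^ 2) • c)) + (exp ((1 / (P.L : ℝ) ^ 2) • c) - 1) := by abel
    rw [hsplit]
    exact (norm_add_le _ _).trans (by linarith)
  have h0 := GaugeGroup.dist1_nonneg W
  have := mul_self_le_mul_self h0 hdist
  nlinarith

/-- One coarse plaquette from below: `½(‖F‖ − ‖F‖²)² ≤ 1 − Re tr V(∂p)` (`e^F = V(∂p)`, `‖F‖ ≤ 1`). [folklore] -/
theorem coarse_term_ge (V : GaugeField P (j+1) (Matrix.specialUnitaryGroup (Fin 2) ℂ)) (p : Plaq P (j+1))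
    (hsmall : ‖((plaqElt V p.src p.μ p.ν : Matrix.specialUnitaryGroup (Fin 2) ℂ) : Matrix (Fin 2) (Fin 2) ℂ) - 1‖ ≤ 1 / 3)
    (hc1 : ‖curv V p.src p.μ p.ν‖ ≤ 1) :
    1 / 2 * (‖curv V p.src p.μ p.ν‖ - ‖curv V p.src p.μ p.ν‖ ^ 2) ^ 2 ≤ 1 - reTr (GaugeField.plaqHol V p) := by
  rw [one_sub_reTr_eq_half_dist1_sq_su2]
  set c := curv V p.src p.μ p.ν with hc
  have hP : GaugeField.plaqHol V p = plaqElt V p.src p.μ p.ν := (plaqElt_eq_plaqHol V p.src p.hμν).symm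
  have hd : dist1 (GaugeField.plaqHol V p) =
      ‖((plaqElt V p.src p.μ p.ν : Matrix.specialUnitaryGroup (Fin 2) ℂ) : Matrix (Fin 2) (Fin 2) ℂ) - 1‖ := by rw [hP]; rfl
  have hce : exp c = ((plaqElt V p.src p.μ p.ν : Matrix.specialUnitaryGroup (Fin 2) ℂ) : Matrix (Fin 2) (Fin 2) ℂ) := by
    rw [hc, curv_of_small hsmall]; exact exp_mlog (hsmall.trans_lt (by norm_num))
  have hlow : ‖c‖ - ‖c‖ ^ 2 ≤ dist1 (GaugeField.plaqHol V p) := by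
    rw [hd, ← hce]; exact norm_sub_sq_le_norm_exp_sub_one c hc1
  have h0 : 0 ≤ ‖c‖ - ‖c‖ ^ 2 := by nlinarith [norm_nonneg c]
  have := mul_self_le_mul_self h0 hlow
  nlinarith

/-- One block of one coarse plaquette: `L⁴ Σ_{x ∈ B(y)} (1 − Re tr interp V(∂⟨x,κ,λ⟩)) ≤ L^d ((1 − Re tr V(∂⟨y,κ,λ⟩)) + Err)`,
`Err = 16a³ + 2aL²K + (4a² + L²K)²`. [cite: King1986, (A.5) p.676] -/
theorem block_action_le (hj : j + 1 ≤ P.m + P.K) (V : GaugeField P (j+1) (Matrix.specialUnitaryGroup (Fin 2) ℂ))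
    {a b' : ℝ} (ha : 0 ≤ a) (hb' : 0 ≤ b') (ha1 : (4 * (P.d : ℝ) + 2) * a ≤ 1)
    (hV : ∀ (y : Site P (j+1)) (κ μ : Fin P.d),
      ‖((plaqElt V y κ μ : Matrix.specialUnitaryGroup (Fin 2) ℂ) : Matrix (Fin 2) (Fin 2) ℂ) - 1‖ ≤ a)
    (hcc : ∀ (y : Site P (j+1)) (κ ρ μ : Fin P.d),
      ‖((V ⟨y, κ⟩ : Matrix.specialUnitaryGroup (Fin 2) ℂ) : Matrix (Fin 2) (Fin 2) ℂ) * curv V (y.shift κ) ρ μ *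
          star ((V ⟨y, κ⟩ : Matrix.specialUnitaryGroup (Fin 2) ℂ) : Matrix (Fin 2) (Fin 2) ℂ) - curv V y ρ μ‖ ≤ b')
    (p : Plaq P (j+1)) :
    (P.L : ℝ) ^ 4 * ∑ r : Fin P.d → Fin P.L, (1 - reTr (GaugeField.plaqHol (interp V) ⟨Site.blockSite p.src r, p.μ, p.ν, p.hμν⟩)) ≤
      (P.L : ℝ) ^ P.d * ((1 - reTr (GaugeField.plaqHol V p)) +
        (16 * a ^ 3 + 2 * a * (P.L : ℝ) ^ 2 * (2 * ((4 * (P.d : ℝ) + 2) * a) ^ 2 + 3 * (P.d : ℝ) * b') +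
          (4 * a ^ 2 + (P.L : ℝ) ^ 2 * (2 * ((4 * (P.d : ℝ) + 2) * a) ^ 2 + 3 * (P.d : ℝ) * b')) ^ 2)) := by
  have hL1 : (1 : ℝ) ≤ P.L := by exact_mod_cast P.L_pos
  have hd1 : (1 : ℝ) ≤ P.d := by exact_mod_cast P.hd
  have ha6 : a ≤ 1 / 6 := by nlinarith
  set K : ℝ := 2 * ((4 * (P.d : ℝ) + 2) * a) ^ 2 + 3 * (P.d : ℝ) * b' with hK
  have hK0 : 0 ≤ K := by positivity
  set n : ℝ := ‖curv V p.src p.μ p.ν‖ with hn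
  have hn2 : n ≤ 2 * a := (norm_curv_le V _ _ _).trans (by linarith [hV p.src p.μ p.ν])
  have hn0 : 0 ≤ n := norm_nonneg _
  have hn1 : n ≤ 1 := by linarith
  -- each fine plaquette of the block
  have hfine : ∀ r : Fin P.d → Fin P.L,
      1 - reTr (GaugeField.plaqHol (interp V) ⟨Site.blockSite p.src r, p.μ, p.ν, p.hμν⟩) ≤
        1 / 2 * (n / (P.L : ℝ) ^ 2 + (n / (P.L : ℝ) ^ 2) ^ 2 + K) ^ 2 := by
    intro r
    have hstr := norm_plaqHol_interp_sub_exp_le hj V ha hb' ha1 hV hcc ⟨Site.blockSite p.src r, p.μ, p.ν, p.hμν⟩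
    have hblock : blockOf (Site.blockSite p.src r) = p.src := Site.blockOf_blockSite hj p.src r
    simp only [hblock] at hstr
    exact fine_term_le hL1 hstr hn1
  have hcoarse : 1 / 2 * (n - n ^ 2) ^ 2 ≤ 1 - reTr (GaugeField.plaqHol V p) :=
    coarse_term_ge V p ((hV _ _ _).trans (by linarith)) hn1
  -- sum over the block: `L^d` equal bounds
  have hcard : (Fintype.card (Fin P.d → Fin P.L) : ℝ) = (P.L : ℝ) ^ P.d := by
    rw [Fintype.card_fun, Fintype.card_fin, Fintype.card_fin]; push_cast; ring
  have hsum : ∑ r : Fin P.d → Fin P.L, (1 - reTr (GaugeField.plaqHol (interp V) ⟨Site.blockSite p.src r, p.μ, p.ν, p.hμν⟩)) ≤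
      (P.L : ℝ) ^ P.d * (1 / 2 * (n / (P.L : ℝ) ^ 2 + (n / (P.L : ℝ) ^ 2) ^ 2 + K) ^ 2) := by
    calc _ ≤ ∑ _r : Fin P.d → Fin P.L, 1 / 2 * (n / (P.L : ℝ) ^ 2 + (n / (P.L : ℝ) ^ 2) ^ 2 + K) ^ 2 :=
          Finset.sum_le_sum fun r _ => hfine r
      _ = _ := by rw [Finset.sum_const, Finset.card_univ, nsmul_eq_mul, hcard]
  have harith := block_arith (K := K) hL1 hn0 hn2 hK0
  have hLd : (0 : ℝ) ≤ (P.L : ℝ) ^ P.d := by positivity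
  calc (P.L : ℝ) ^ 4 * ∑ r : Fin P.d → Fin P.L, (1 - reTr (GaugeField.plaqHol (interp V) ⟨Site.blockSite p.src r, p.μ, p.ν, p.hμν⟩))
      ≤ (P.L : ℝ) ^ 4 * ((P.L : ℝ) ^ P.d * (1 / 2 * (n / (P.L : ℝ) ^ 2 + (n / (P.L : ℝ) ^ 2) ^ 2 + K) ^ 2)) := by gcongr
    _ = (P.L : ℝ) ^ P.d * ((P.L : ℝ) ^ 4 * (1 / 2 * (n / (P.L : ℝ) ^ 2 + (n / (P.L : ℝ) ^ 2) ^ 2 + K) ^ 2)) := by ring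
    _ ≤ (P.L : ℝ) ^ P.d * (1 / 2 * (n - n ^ 2) ^ 2 +
          (16 * a ^ 3 + 2 * a * (P.L : ℝ) ^ 2 * K + (4 * a ^ 2 + (P.L : ℝ) ^ 2 * K) ^ 2)) := by gcongr
    _ ≤ _ := by gcongr

/-- **THE INTERPOLATION CARRIES `L^{d−4}` OF THE WILSON ACTION**:
`L⁴·A(interp V) ≤ L^d·(A(V) + #{coarse plaquettes}·(16a³ + 2aL²K + (4a² + L²K)²))`, `K = 2((4d+2)a)² + 3d·b′` — for `d = 3` the
one-step smooth lift carries exactly `1/L` of the coarse action up to a defect cubic in the field and linear in the covariant-constancy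
defect (clause (iv) of G-K1a-2′ before the exact correction). [cite: King1986, (A.5) p.676] -/
theorem wilsonAction4_interp_le (hj : j + 1 ≤ P.m + P.K) (V : GaugeField P (j+1) (Matrix.specialUnitaryGroup (Fin 2) ℂ))
    {a b' : ℝ} (ha : 0 ≤ a) (hb' : 0 ≤ b') (ha1 : (4 * (P.d : ℝ) + 2) * a ≤ 1)
    (hV : ∀ (y : Site P (j+1)) (κ μ : Fin P.d),
      ‖((plaqElt V y κ μ : Matrix.specialUnitaryGroup (Fin 2) ℂ) : Matrix (Fin 2) (Fin 2) ℂ) - 1‖ ≤ a)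
    (hcc : ∀ (y : Site P (j+1)) (κ ρ μ : Fin P.d),
      ‖((V ⟨y, κ⟩ : Matrix.specialUnitaryGroup (Fin 2) ℂ) : Matrix (Fin 2) (Fin 2) ℂ) * curv V (y.shift κ) ρ μ *
          star ((V ⟨y, κ⟩ : Matrix.specialUnitaryGroup (Fin 2) ℂ) : Matrix (Fin 2) (Fin 2) ℂ) - curv V y ρ μ‖ ≤ b') :
    (P.L : ℝ) ^ 4 * wilsonAction4 (interp V) ≤
      (P.L : ℝ) ^ P.d * (wilsonAction4 V + (Fintype.card (Plaq P (j+1)) : ℝ) *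
        (16 * a ^ 3 + 2 * a * (P.L : ℝ) ^ 2 * (2 * ((4 * (P.d : ℝ) + 2) * a) ^ 2 + 3 * (P.d : ℝ) * b') +
          (4 * a ^ 2 + (P.L : ℝ) ^ 2 * (2 * ((4 * (P.d : ℝ) + 2) * a) ^ 2 + 3 * (P.d : ℝ) * b')) ^ 2)) := by
  set Err := 16 * a ^ 3 + 2 * a * (P.L : ℝ) ^ 2 * (2 * ((4 * (P.d : ℝ) + 2) * a) ^ 2 + 3 * (P.d : ℝ) * b') +
    (4 * a ^ 2 + (P.L : ℝ) ^ 2 * (2 * ((4 * (P.d : ℝ) + 2) * a) ^ 2 + 3 * (P.d : ℝ) * b')) ^ 2 with hErr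
  unfold wilsonAction4 wilsonAction
  simp only [one_mul]
  rw [← sum_coarse_block hj (fun q => 1 - reTr (GaugeField.plaqHol (interp V) q)), Finset.mul_sum]
  calc ∑ p : Plaq P (j+1), (P.L : ℝ) ^ 4 * ∑ r : Fin P.d → Fin P.L,
        (1 - reTr (GaugeField.plaqHol (interp V) ⟨Site.blockSite p.src r, p.μ, p.ν, p.hμν⟩))
      ≤ ∑ p : Plaq P (j+1), (P.L : ℝ) ^ P.d * ((1 - reTr (GaugeField.plaqHol V p)) + Err) :=
        Finset.sum_le_sum fun p _ => block_action_le hj V ha hb' ha1 hV hcc p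
    _ = (P.L : ℝ) ^ P.d * (∑ p : Plaq P (j+1), (1 - reTr (GaugeField.plaqHol V p)) + (Fintype.card (Plaq P (j+1)) : ℝ) * Err) := by
        rw [← Finset.mul_sum, Finset.sum_add_distrib, Finset.sum_const, Finset.card_univ, nsmul_eq_mul]

end Summit.QuantumFields.YangMills.Theorems.SmoothLiftInterp

end
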